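import Summits.RiemannHypothesis.RiemannHypothesis.Theses.LeeYang
import Summits.RiemannHypothesis.RiemannHypothesis.Theorems.LeeYangLeeyangThesis
import HarnessLib

/-!
# RiemannHypothesis / LeeYang — support item `LeeyangThesisImpliesRH` (X ⇒ RH)

Route `RiemannHypothesis/LeeYang`, item `stmt-RiemannHypothesis-8946`:
`LeeyangThesisImpliesRH := LeeyangThesis → Summit.RiemannHypothesis`.

The thesis X (`LeeyangThesis`: the normalised Pólya–de Bruijn law `ν_Φ = Φ(u) du / ∫Φ` is an
Ising limit law) implies the Riemann hypothesis: `ν_Φ` is a probability measure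
(`0 < ∫Φ < ∞`), X makes it an Ising limit law, Newman's closure theorem
(`Literature.Probability.LatticeModels.hasLeeYangProperty_of_isIsingLimitLaw_holds`, proved in the
tree from the finite Lee–Yang circle theorem via Asano contractions + Hurwitz) gives it the Lee–Yang
property, so every zero of the Laplace transform `z ↦ ∫ e^{zu} Φ(u) du` is purely imaginary, and
Pólya's representation `∫ e^{zu} Φ = 2·H₀(iz)`
(`Literature.NumberTheory.LFunctions.riemannHypothesis_of_deBruijnPhi_laplace_zeros_holds`) turns
that into RH. This derivation is exactly the route's deciding theorem
`Summit.RiemannHypothesis.RiemannHypothesis.Theses.LeeYang.closes` (proved inline in the route file,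
axioms `propext`/`Classical.choice`/`Quot.sound`), so the item is closed by citing it; an
independent second proof through the bookkeeping file `Theorems/LeeYangLeeyangThesis.lean`
(`Summit.RiemannHypothesis.LeeYang.riemannHypothesis_of_leeyangThesis`, whose named-fact hypothesis
`hasLeeYangProperty_of_isIsingLimitLaw` is now discharged in the tree) is recorded as well.
-/

namespace Summit.RiemannHypothesis.RiemannHypothesis.Theorems

open Summit.RiemannHypothesis.RiemannHypothesis.Theses.LeeYang

/-- **Item `stmt-RiemannHypothesis-8946` (`LeeyangThesisImpliesRH`).** The Lee–Yang thesis X —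
the normalised de Bruijn law `Φ du / ∫Φ` is an Ising limit law — implies the Riemann hypothesis
(Newman's closure theorem + Pólya's representation; this is the route's deciding theorem `closes`).
[folklore] -/
theorem leeyangThesisImpliesRH_proof : LeeyangThesisImpliesRH := by
  unfold LeeyangThesisImpliesRH
  exact closes

/-- Second derivation of the same item, through the bookkeeping file
`Theorems/LeeYangLeeyangThesis.lean`: `riemannHypothesis_of_leeyangThesis` there takes Newman's
closure theorem as a named-fact hypothesis, which the tree now discharges
(`hasLeeYangProperty_of_isIsingLimitLaw_holds`). [folklore] -/
theorem leeyangThesisImpliesRH_proof' : LeeyangThesisImpliesRH := fun hX =>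
  Summit.RiemannHypothesis.LeeYang.riemannHypothesis_of_leeyangThesis
    Literature.Probability.LatticeModels.hasLeeYangProperty_of_isIsingLimitLaw_holds hX

end Summit.RiemannHypothesis.RiemannHypothesis.Theorems
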